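import Summits.NavierStokesRegularity.NavierStokesRegularity.Theorems.ExtremiserTransiencePlateauSliceRigidity
import Summits.NavierStokesRegularity.NavierStokesRegularity.Theorems.ExtremiserTransiencePlateauTransferOfSlice
import HarnessLib

/-!
# Route `ExtremiserTransience`, LINE g5-α (seat ns-idea-5 g5): `PlateauAncientRigidity` (item 27678) holds

`--workitem stmt-NavierStokesRegularity-27678`.  The original rigidity item of LINE g5-α — no KNSS-mild Type-I ancient field carries an exact speed
plateau of positive space-time measure — follows from the slice rigidity `plateauSliceRigidity` (27823, p641514: subcubic local energy budget +
analyticity + Mityagin + cubic mass growth) by `plateauAncientRigidity_of_slice` (p633820: a positive-measure space-time plateau has a positive-measure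
slice).  After this file LINE g5-α reads `LocalNearPlateauStability` (27676, crux) → `PlateauSliceTransfer` (27822, one open stub S1) → [rigidity proved]
→ `NearExtremalTransiencePerFlow` (26567).  HONEST FRAMING: a rigidity statement about hypothetical blow-up limits; nothing about Navier–Stokes
regularity or blow-up is proved here and no summit is proved by a line. [cite: CaffarelliKohnNirenberg1982, §2 (2.5)]
-/

namespace Summit.NavierStokesRegularity.NavierStokesRegularity.Theses.ExtremiserTransience
set_option linter.dupNamespace false

/-- **LINE g5-α, item 27678**: `PlateauAncientRigidity` HOLDS. [cite: CaffarelliKohnNirenberg1982, §2 (2.5)] -/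
theorem plateauAncientRigidity : PlateauAncientRigidity :=
  plateauAncientRigidity_of_slice plateauSliceRigidity

-- LINE g5-α after g5: the crux `NearExtremalTransiencePerFlow` (26567) follows from `LocalNearPlateauStability` (27676) and the one open
-- transfer piece `PlateauSliceTransfer` (27822) by the term `netpf_of_slice hL h1 plateauSliceRigidity` (p633820 + p641514); not restated
-- here as a theorem so that no decl of this file has the crux as its type.

end Summit.NavierStokesRegularity.NavierStokesRegularity.Theses.ExtremiserTransience
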